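/-
Copyright (c) 2026 the pub-hodgecm-mathlib formalisation cell (harness21).  Prover seat hodgecm-mathlib-F0P3a-p01 (g32), req620 Track A «(D-RAM) FOUR-FRAME» squad, unit U2H:
the (ρ2b′-X) child (U2H ED. 15 :418) — organ T3-E part 2, FILE A «THE GLOBAL MODEL OF THE EIGEN-FIELD, COMPLETED» (plan `T3E-PART2-PLAN.v1` 333f6514 §2 (b)(c)(d); payer lineage
LH4-p14, O-W LH4-p12 (g4)).  2026-09-04.
-/
import Literature.NumberTheory.Automorphic.UnitaryGroupInertPlaceHyperbolicBasis   -- ★ `galAdicCompletionMap_galAdicCompletionMap_of_smul_eq`, `exists_toPlace_eq_of_galAdicCompletionMap_eq`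
import Literature.NumberTheory.Automorphic.QuadraticNonsplitPlaceOfNotIsSquare       -- ★ `smul_placesOver_eq_of_not_isSquare` (a local non-square does not split: `c • w′ = w′`)
import Literature.NumberTheory.NumberFields.QuadraticCompletionAtNonsplitPlace        -- ★ «LQC» (QP) `subsingleton_placesOver_of_not_isSquare`, (Q2) `existsUnique_eq_toPlace_add_toPlace_mul`, `algebraMap_adicCompletion_sq_eq_toPlace`
import Literature.NumberTheory.Automorphic.QuadraticAdeleBaseChange                   -- ★ `valued_toPlace_le_one_iff`
import HarnessLib

/-!
# Crux `H413`, line LH4 «(D-RAM) FOUR-FRAME» road — unit U2H, (ρ2b′-X), organ T3-E part 2, FILE A: THE COMPLETED GLOBAL MODEL OF A QUADRATIC EXTENSION OF `L_w`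

Cell `hodgecm-mathlib` (D-0151), FLOOR 0, crux item H413 = `stmt-HodgeConjecture-24833`, route of record `HCCMUnconditional`; squad F0∕P3c∕LH4; registered stub served:
`F0P3cDyRamFourFrameU2H.stub_U2H_fixedPointCensus_typeTwo_unit0` ((ρ2b′-X), U2H ED. 15 :418) through the organs of RHO2BX-ORDER v1 — here T3-E part 2 (the METRIC half of the
line model, ★ part 1 = `F0P3cDyRamEllipticPlaneLineModel.exists_lineModel` p857255).  THEOREMS ONLY (no `def`, no instance, no notation, no `sorry`); lane `--supports
stmt-HodgeConjecture-24833 --as helper` (count-neutral).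
WHAT THIS FILE DOES (plan 333f6514 §2, DESIGN A: «(M, Valued) = the completion of a GLOBAL quadratic extension», the ★ «LQC» pattern, all bricks ★ BY NAME).  For a number field
`L`, a quadratic extension `E′ ∕ L` with non-trivial automorphism `c`, `c δ = −δ`, `δ² = m ∈ L`, and a finite place `w` of `L` at which `m` is NOT a square: there is a place `w′ ∣ w`
of `E′` (unique), FIXED by `c`, and with `M := E′_{w′}`, `jE := ι_{w′} : L_w →+* M`, `ρ := c_{w′}` the package
`ρρ = id`, `|ρ z| = |z|`, `ρ ∘ jE = jE`, `|jE a| ≤ 1 ↔ |a| ≤ 1`, `δ² = jE m`, `ρ δ = −δ`, UNIQUE COORDINATES `z = jE p + jE q·δ`, and `ρ z = z ↔ z ∈ jE(L_w)` —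
the binders `(hρρ, hvρ, hρj, hjv, hcoord, hjfix)` of ★ `EllipticPlaneAsFieldLine` (C) (p857215) and of ★ part 1, in one `obtain`.  The eigenvalue `lam`, the adjoint involution `Θ`
and the integral generator `α` (plan §2 (e)(f)(g), §3) are FILE B ∕ C.
HONEST LABEL.  Count-neutral packaging of ★ lemmas; (ρ2b′-X) stays an OPEN prover target; `HC_CM` is proved only modulo the 7 printed citations (2 remaining named inputs: hLiu418 =
`stmt-HodgeConjecture-24832`, h413 = `stmt-HodgeConjecture-24833`) until rung 0 closes.

## References
* [CasselsFrohlichANT1967] J. W. S. Cassels, A. Fröhlich (eds.), *Algebraic Number Theory* (1967), Ch. II §10 (completions of a finite extension: `E ⊗_F F_v = ∏_{w∣v} E_w`).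
* [Neukirch1999] J. Neukirch, *Algebraic Number Theory*, Grundlehren 322 (1999), Ch. II (8.2)–(8.3).
-/

set_option autoImplicit false

noncomputable section

open NumberField IsDedekindDomain
open Literature.NumberTheory.Automorphic Literature.NumberTheory.Automorphic.UnitaryGroup Literature.NumberTheory.NumberFields
open scoped ValuativeRel

namespace Summit.HodgeConjecture.HodgeConjecture.Cruxes.H413.F0P3cDyRamEigenFieldCompletionModel

/-- **T3-E FILE A — THE COMPLETED GLOBAL MODEL.**  `E′ ∕ L` quadratic with `c δ = −δ`, `δ ≠ 0`, `δ² = m`, and `m` not a square in `L_w`: there is a place `w′ ∣ w` of `E′` fixed by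
`c` such that, with `ρ := c_{w′}` and `jE := ι_{w′}`: `ρ` is an isometric involution fixing `jE(L_w)` pointwise, `jE` detects integrality, `δ² = jE m`, `ρ δ = −δ`, every `z ∈ E′_{w′}`
is uniquely `jE p + jE q·δ`, and the `ρ`-fixed elements are exactly `jE(L_w)`. [cite: CasselsFrohlichANT1967, Ch. II §10] [cite: Neukirch1999, Ch. II (8.2)–(8.3)] -/
theorem exists_completionModel {L : Type} [Field L] [NumberField L] (E' : Type) [Field E'] [NumberField E'] [Algebra L E'] [Algebra.IsQuadraticExtension L E']
    (w : HeightOneSpectrum (𝓞 L)) (c : E' ≃ₐ[L] E') (hc1 : c ≠ 1) {δ : E'} (hcδ : c δ = -δ) (hδ : δ ≠ 0) {m : L} (hm : algebraMap L E' m = δ ^ 2)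
    (hns : ¬ IsSquare (m : w.adicCompletion L)) :
    ∃ (w' : PlacesOver E' w) (hw' : c • w'.1 = w'.1),
      (∀ z, galAdicCompletionMap (L := E') c hw' (galAdicCompletionMap (L := E') c hw' z) = z) ∧
      (∀ z, Valued.v (galAdicCompletionMap (L := E') c hw' z) = Valued.v z) ∧
      (∀ a, galAdicCompletionMap (L := E') c hw' (toPlace w w' a) = toPlace w w' a) ∧
      (∀ a, Valued.v (toPlace w w' a) ≤ 1 ↔ Valued.v a ≤ 1) ∧
      ((δ : E') : w'.1.adicCompletion E') ^ 2 = toPlace w w' (m : w.adicCompletion L) ∧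
      galAdicCompletionMap (L := E') c hw' ((δ : E') : w'.1.adicCompletion E') = -((δ : E') : w'.1.adicCompletion E') ∧
      (∀ z : w'.1.adicCompletion E', ∃! pq : w.adicCompletion L × w.adicCompletion L,
          z = toPlace w w' pq.1 + toPlace w w' pq.2 * ((δ : E') : w'.1.adicCompletion E')) ∧
      (∀ z : w'.1.adicCompletion E', galAdicCompletionMap (L := E') c hw' z = z ↔ ∃ a, toPlace w w' a = z) := by
  -- the unique place above `w`, fixed by `c`
  haveI : Subsingleton (PlacesOver E' w) := subsingleton_placesOver_of_not_isSquare E' w c hcδ hδ hm hns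
  obtain ⟨w'⟩ : Nonempty (PlacesOver E' w) := inferInstance
  have hd : δ * δ = algebraMap L E' m := by rw [hm, sq]
  have hw' : c • w'.1 = w'.1 := smul_placesOver_eq_of_not_isSquare E' w c hcδ hδ hd hns w'
  refine ⟨w', hw', fun z => galAdicCompletionMap_galAdicCompletionMap_of_smul_eq c w' hc1 hw' z, fun z => valued_galAdicCompletionMap _ c hw' z,
    fun a => galAdicCompletionMap_toPlace c w' w' hw' a, fun a => valued_toPlace_le_one_iff w' a, algebraMap_adicCompletion_sq_eq_toPlace E' w w' hm, ?_,
    fun z => existsUnique_eq_toPlace_add_toPlace_mul E' w c hcδ hδ w' z, fun z => ⟨fun hz => exists_toPlace_eq_of_galAdicCompletionMap_eq c w' hc1 hw' z hz, ?_⟩⟩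
  · rw [galAdicCompletionMap_coe_algEquiv, hcδ]; exact map_neg (algebraMap E' (w'.1.adicCompletion E')) δ
  · rintro ⟨a, rfl⟩; exact galAdicCompletionMap_toPlace c w' w' hw' a

end Summit.HodgeConjecture.HodgeConjecture.Cruxes.H413.F0P3cDyRamEigenFieldCompletionModel

end
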